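import Summits.CriticalPhenomena.SAWScalingLimit.Theses.SAWPoissonBanks

/-!
# Route `SAWPoissonBanks`: the assembly (item `stmt-CriticalPhenomena-4780`)

`Assembly : LSWSimpleRestrictionIsSLE → PoissonRigidity → PoissonianBanks → BanksOfLimit →
LimitExists → AxiomsOfLimit → SAWScalingLimit`.

Plumbing only: take the limit family `P` from `LimitExists`; `AxiomsOfLimit` gives restriction,
the restriction-coupled Markov extension, reversibility, similarity and conjugation covariance and
simplicity; `BanksOfLimit` applied to `PoissonianBanks` gives the alternation tower of `P` on both
sides; `PoissonRigidity` upgrades to conformal covariance; `LSWSimpleRestrictionIsSLE` identifies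
`P D` with the chordal SLE_{8/3} law in every Dobrushin domain, and `integral_map` transports the
weak convergence `TendstoLaw … id (P D)` to the SLE curve. This is exactly the route's deciding
theorem `Theses.SAWPoissonBanks.closes`, so the item is discharged by it.

## References

* G. F. Lawler, O. Schramm, W. Werner, *Conformal restriction: the chordal case*, J. Amer. Math.
  Soc. 16 (2003) [LawlerSchrammWerner2003Restriction].
* G. F. Lawler, O. Schramm, W. Werner, *On the scaling limit of planar self-avoiding walk*, Proc.
  Sympos. Pure Math. 72 (2004) [LawlerSchrammWerner2004SAW].
-/

namespace Summit.CriticalPhenomena.SAWScalingLimit.Theorems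

/-- **Item `stmt-CriticalPhenomena-4780` (`SAWPoissonBanks.Assembly`):**
`LSWSimpleRestrictionIsSLE → PoissonRigidity → PoissonianBanks → BanksOfLimit → LimitExists →
AxiomsOfLimit → SAWScalingLimit`, by the route's deciding theorem
`Theses.SAWPoissonBanks.closes` (limit family from `LimitExists`, axioms from `AxiomsOfLimit`,
banks from `BanksOfLimit ∘ PoissonianBanks`, conformal covariance from `PoissonRigidity`,
identification with chordal SLE_{8/3} from `LSWSimpleRestrictionIsSLE`). -/
theorem poissonBanks_assembly_proof : Theses.SAWPoissonBanks.Assembly := by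
  unfold Theses.SAWPoissonBanks.Assembly
  intro hLSW hPR hPB hBanks hLim hAx
  exact Theses.SAWPoissonBanks.closes hLSW hPR hPB hBanks hLim hAx

end Summit.CriticalPhenomena.SAWScalingLimit.Theorems
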